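import Mathlib.Logic.Relation
import Mathlib.Data.List.Basic
import Mathlib.Data.Int.Notation
import Mathlib.Data.Nat.Notation
import HarnessLib

/-!
# ω-census family (a4): a generic kernel checker for `𝔽₂` flip components of small matrix-multiplication schemes

Cell `pub-omega` (HOME `run/shared/lean/pub/pub-omega/`, unit `pub-omega-eng2`, ENG2 gen 4), topic
`Summits/MatrixMultiplication/OmegaCensus`.  Framing (verbatim): lottery ticket; floor = certified bounds/negative ranges.
HONEST FRAMING: infrastructure for kernel-checking FINITE LOCAL FACTS about explicit flip graphs (census sub-family (a4): "the flip
component of scheme `X` over `𝔽₂` is exactly this finite list and contains no reducible scheme").  Such facts are NOT lower bounds on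
any rank (Kauers–Moosbauer flip graphs are connected only with the extra "plus"/reduction transitions, excluded here) and nothing here
is progress on `ω`.  `FlipComponent234GF2*.lean` is the `⟨2,3,4⟩:20` instance written out by hand; this file abstracts it so that other
tree-held schemes get the same treatment from a data block and a few `decide +kernel` lines.

## The graph (parameters `bu bv : ℕ`, the bit widths of the first two factors)

A rank-one term over `𝔽₂` is a triple of supports `(u, v, w)` packed as `p = u + 2^bu · v + 2^(bu+bv) · w`; a scheme is the SORTED list
of its packed terms (a multiset).  `flipsP bu bv s` lists the Kauers–Moosbauer flips of `s` (arXiv:2212.01175 §3) in the census move set: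
for every pair of terms `i < j` (list order) agreeing in one position `P` with a NONZERO common factor, `Q < R` the other two positions, the
two schemes given by the roles `(a,b) = (i,j)` and `(j,i)`: term `a` gets `Q_a ⊕ Q_b` in position `Q`, term `b` gets `R_b ⊕ R_a` in position
`R` (the represented tensor is unchanged); results are re-sorted.  `reducibleB bu bv s`: some term has an empty factor, or two terms agree
in two positions (an "`r−1` node": the scheme rewrites with fewer terms).

## What is proved (once, for all parameters)

Given data `L` (candidate component, `n` sorted schemes), `cert` (row `k` = indices in `L` of the flip results of `L[k]`, in `flipsP`
order), `parent`/`depth` (a BFS tree) and a root index with `nth L root = X`: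
* `mem_of_reach` — if every certificate row checks (`rowK … k = true` for all `k < n`), every scheme reachable from `X` is in `L`;
* `reach_of_mem` — if every parent row checks (`parentOK … k = true` for all `k < n`), every scheme of `L` is reachable from `X`;
* `component_iff` — both: reachable ⇔ listed;  `nodup_of_nodupB`, `not_reducible_of_all` — the Boolean side checks are sound.
Instances discharge the row hypotheses by chunked `decide +kernel` (the kernel's per-declaration memory cap forces chunks) and
`of_all_iota`.  References: Kauers–Moosbauer [KauersMoosbauer2022FlipGraphs]; the schemes come from
`Literature/…/SmallFormatMatMulRankUpper.lean` (Hopcroft–Kerr 1971, Smirnov 2013, catalogue). [HopcroftKerr1971]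
-/

namespace Summit.MatrixMultiplication.OmegaCensus.FlipComponentGF2

/-! ### Packed rank-one terms over `𝔽₂` -/

/-- First-factor mask (`bu` bits). -/
def cU (bu : ℕ) (p : ℕ) : ℕ := p % 2 ^ bu

/-- Second-factor mask (`bv` bits). -/
def cV (bu bv : ℕ) (p : ℕ) : ℕ := p / 2 ^ bu % 2 ^ bv

/-- Third-factor mask (the remaining high bits). -/
def cW (bu bv : ℕ) (p : ℕ) : ℕ := p / 2 ^ (bu + bv)

/-- Pack three masks. -/
def pack (bu bv : ℕ) (u v w : ℕ) : ℕ := u + 2 ^ bu * v + 2 ^ (bu + bv) * w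

/-- Insert into a sorted list of naturals. -/
def ins (a : ℕ) : List ℕ → List ℕ
  | [] => [a]
  | b :: l => if a ≤ b then a :: b :: l else b :: ins a l

/-- Insertion sort (canonical form = sorted list of packed terms). -/
def isort : List ℕ → List ℕ
  | [] => []
  | a :: l => ins a (isort l)

/-- Boolean sortedness (non-decreasing). -/
def sortedB : List ℕ → Bool
  | [] => true
  | [_] => true
  | a :: b :: l => decide (a ≤ b) && sortedB (b :: l)

/-! ### Flips (pairs enumerated along the list; the scheme minus the two flipped terms stays sorted, the two new terms are inserted) -/

/-- The scheme consisting of the untouched terms (`preR`, `midR` are reversed accumulators) with the two new terms inserted. -/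
def assemble (preR midR post : List ℕ) (na nb : ℕ) : List ℕ :=
  ins na (ins nb (preR.reverseAux (midR.reverseAux post)))

/-- The flips of the pair `(ti, tj)` (`ti` earlier in the list): shared position `u`, then `v`, then `w`; for each, roles `(i,j)` then
`(j,i)`.  Shared `u`: `(Q,R) = (v,w)`; shared `v`: `(u,w)`; shared `w`: `(u,v)`. -/
def pairFlips (bu bv : ℕ) (preR midR post : List ℕ) (ti tj : ℕ) : List (List ℕ) :=
  let ui := cU bu ti
  let uj := cU bu tj
  let vi := cV bu bv ti
  let vj := cV bu bv tj
  let wi := cW bu bv ti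
  let wj := cW bu bv tj
  (if ui = uj ∧ ui ≠ 0 then
    [assemble preR midR post (pack bu bv ui (Nat.xor vi vj) wi) (pack bu bv uj vj (Nat.xor wj wi)),
     assemble preR midR post (pack bu bv uj (Nat.xor vj vi) wj) (pack bu bv ui vi (Nat.xor wi wj))]
   else []) ++
  (if vi = vj ∧ vi ≠ 0 then
    [assemble preR midR post (pack bu bv (Nat.xor ui uj) vi wi) (pack bu bv uj vj (Nat.xor wj wi)),
     assemble preR midR post (pack bu bv (Nat.xor uj ui) vj wj) (pack bu bv ui vi (Nat.xor wi wj))]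
   else []) ++
  (if wi = wj ∧ wi ≠ 0 then
    [assemble preR midR post (pack bu bv (Nat.xor ui uj) vi wi) (pack bu bv uj (Nat.xor vj vi) wj),
     assemble preR midR post (pack bu bv (Nat.xor uj ui) vj wj) (pack bu bv ui (Nat.xor vi vj) wi)]
   else [])

/-- Inner loop: partner terms `tj` after `ti`. -/
def flipsFrom (bu bv : ℕ) (preR : List ℕ) (ti : ℕ) : List ℕ → List ℕ → List (List ℕ)
  | _, [] => []
  | midR, tj :: post => pairFlips bu bv preR midR post ti tj ++ flipsFrom bu bv preR ti (tj :: midR) post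

/-- Outer loop: first term `ti`. -/
def flipsAll (bu bv : ℕ) : List ℕ → List ℕ → List (List ℕ)
  | _, [] => []
  | preR, ti :: rest => flipsFrom bu bv preR ti [] rest ++ flipsAll bu bv (ti :: preR) rest

/-- All flip neighbours (canonical forms, with multiplicity) of a sorted scheme, in the fixed enumeration order
(pairs `i < j` in list order; shared position `u, v, w`; roles `(i,j), (j,i)`). -/
def flipsP (bu bv : ℕ) (s : List ℕ) : List (List ℕ) := flipsAll bu bv [] s

/-! ### Reducible (`r − 1`) nodes -/

/-- A term with an empty factor. -/
def zeroFactor (bu bv : ℕ) (p : ℕ) : Bool := (cU bu p == 0) || (cV bu bv p == 0) || (cW bu bv p == 0)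

/-- Two terms agreeing in two of the three positions. -/
def sharesTwo (bu bv : ℕ) (p q : ℕ) : Bool :=
  (cU bu p == cU bu q && cV bu bv p == cV bu bv q) || (cU bu p == cU bu q && cW bu bv p == cW bu bv q) ||
    (cV bu bv p == cV bu bv q && cW bu bv p == cW bu bv q)

/-- Some pair of terms is mergeable. -/
def pairShares (bu bv : ℕ) : List ℕ → Bool
  | [] => false
  | p :: l => l.any (sharesTwo bu bv p) || pairShares bu bv l

/-- REDUCIBLE scheme: a droppable term or a mergeable pair. -/
def reducibleB (bu bv : ℕ) (s : List ℕ) : Bool := s.any (zeroFactor bu bv) || pairShares bu bv s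

/-! ### Start vertices from integer tables -/

/-- Bitmask of an integer row mod `2`: bit `i` set iff entry `i` is odd. -/
def maskRow : List ℤ → ℕ
  | [] => 0
  | x :: l => (if x % 2 = 0 then 0 else 1) + 2 * maskRow l

/-- Pack three parallel integer tables (rows = terms) into packed `𝔽₂` terms. -/
def zip3pack (bu bv : ℕ) : List (List ℤ) → List (List ℤ) → List (List ℤ) → List ℕ
  | a :: as, b :: bs, c :: cs => pack bu bv (maskRow a) (maskRow b) (maskRow c) :: zip3pack bu bv as bs cs
  | _, _, _ => []

/-- Canonical `𝔽₂` scheme from three integer tables (`u`, `v`, `w` tables in this order), reduced mod `2`. -/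
def ofTables (bu bv : ℕ) (tu tv tw : List (List ℤ)) : List ℕ := isort (zip3pack bu bv tu tv tw)

/-! ### List access -/

/-- `j`-th scheme of a list (`[]` out of range). -/
def nth : List (List ℕ) → ℕ → List ℕ
  | [], _ => []
  | a :: _, 0 => a
  | _ :: l, j + 1 => nth l j

/-- `j`-th natural of a list (`0` out of range). -/
def nthN : List ℕ → ℕ → ℕ
  | [], _ => 0
  | a :: _, 0 => a
  | _ :: l, j + 1 => nthN l j

/-- In-range elements are members. -/
theorem nth_mem : ∀ (l : List (List ℕ)) (j : ℕ), j < l.length → nth l j ∈ l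
  | [], _, h => absurd h (by simp)
  | a :: l, 0, _ => by simp [nth]
  | a :: l, j + 1, h => by
    simp only [List.length_cons] at h
    exact List.mem_cons_of_mem a (nth_mem l j (by omega))

/-- Members have an in-range index. -/
theorem exists_nth_of_mem : ∀ (l : List (List ℕ)) (t : List ℕ), t ∈ l → ∃ j, j < l.length ∧ nth l j = t
  | [], t, h => absurd h (by simp)
  | a :: l, t, h => by
    rcases List.mem_cons.mp h with rfl | h'
    · exact ⟨0, by simp, rfl⟩
    · obtain ⟨j, hj, hjt⟩ := exists_nth_of_mem l t h'
      exact ⟨j + 1, by simp only [List.length_cons]; omega, by simpa [nth] using hjt⟩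

/-- The interval `[a, a + n)` as a list (structural, for chunked kernel checks). -/
def iota (a : ℕ) : ℕ → List ℕ
  | 0 => []
  | n + 1 => a :: iota (a + 1) n

/-- Membership in `iota`. -/
theorem mem_iota : ∀ (n a k : ℕ), a ≤ k → k < a + n → k ∈ iota a n
  | 0, _, _, h1, h2 => absurd h2 (by omega)
  | n + 1, a, k, h1, h2 => by
    by_cases hk : k = a
    · subst hk; simp [iota]
    · exact List.mem_cons_of_mem a (mem_iota n (a + 1) k (by omega) (by omega))

/-- From a chunked `all` to a pointwise statement. -/
theorem of_all_iota {f : ℕ → Bool} {a n : ℕ} (h : (iota a n).all f = true) (k : ℕ) (h1 : a ≤ k) (h2 : k < a + n) :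
    f k = true :=
  List.all_eq_true.mp h k (mem_iota n a k h1 h2)

/-! ### The certificate rows -/

/-- Closure row `k`: `L[k]` is sorted, every listed index is `< n`, and the flips of `L[k]` are exactly the listed entries of `L`. -/
def rowK (bu bv n : ℕ) (L cert : List (List ℕ)) (k : ℕ) : Bool :=
  sortedB (nth L k) && (nth cert k).all (fun j => decide (j < n)) && (flipsP bu bv (nth L k) == (nth cert k).map (nth L))

/-- Exhaustion row `k`: the root is `X` at depth `0`; any other scheme is a flip neighbour of its parent, one level up. -/
def parentOK (bu bv n : ℕ) (L : List (List ℕ)) (parent depth : List ℕ) (root : ℕ) (X : List ℕ) (k : ℕ) : Bool :=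
  if k = root then (nthN depth k == 0) && (nth L k == X)
  else decide (nthN parent k < n) && (nthN depth k == nthN depth (nthN parent k) + 1) &&
    (flipsP bu bv (nth L (nthN parent k))).contains (nth L k)

/-- Duplicate-freeness test. -/
def nodupB : List (List ℕ) → Bool
  | [] => true
  | a :: l => !(l.contains a) && nodupB l

/-! ### Soundness -/

section Sound

variable {bu bv n : ℕ} {L cert : List (List ℕ)} {parent depth : List ℕ} {root : ℕ} {X : List ℕ}

/-- Closure: if every row checks, `L` is closed under flips. -/
theorem closed (hn : L.length = n) (hrow : ∀ k, k < n → rowK bu bv n L cert k = true)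
    (s : List ℕ) (hs : s ∈ L) (t : List ℕ) (ht : t ∈ flipsP bu bv s) : t ∈ L := by
  obtain ⟨k, hk, rfl⟩ := exists_nth_of_mem L s hs
  have h := hrow k (by omega)
  simp only [rowK, Bool.and_eq_true, List.all_eq_true, decide_eq_true_eq, beq_iff_eq] at h
  obtain ⟨⟨_, hlt⟩, heq⟩ := h
  rw [heq] at ht
  obtain ⟨j, hj, hjt⟩ := List.mem_map.mp ht
  rw [← hjt]
  exact nth_mem L j (by rw [hn]; exact hlt j hj)

/-- Every scheme reachable from `X ∈ L` is in `L`. -/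
theorem mem_of_reach (hn : L.length = n) (hrow : ∀ k, k < n → rowK bu bv n L cert k = true) (hX : X ∈ L)
    {t : List ℕ} (h : Relation.ReflTransGen (fun s t : List ℕ => t ∈ flipsP bu bv s) X t) : t ∈ L := by
  induction h with
  | refl => exact hX
  | tail _ hst ih => exact closed hn hrow _ ih _ hst

/-- Every scheme of `L` at BFS depth `d` is reachable from `X`. -/
theorem reach_of_depth (hroot : nth L root = X)
    (hpar : ∀ k, k < n → parentOK bu bv n L parent depth root X k = true) :
    ∀ (d k : ℕ), k < n → nthN depth k = d →
      Relation.ReflTransGen (fun s t : List ℕ => t ∈ flipsP bu bv s) X (nth L k) := by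
  intro d
  induction d with
  | zero =>
    intro k hk hd
    have h := hpar k hk
    unfold parentOK at h
    by_cases hkx : k = root
    · subst hkx
      exact (congrArg (Relation.ReflTransGen (fun s t : List ℕ => t ∈ flipsP bu bv s) X) hroot).mpr
        Relation.ReflTransGen.refl
    · rw [if_neg hkx] at h
      simp only [Bool.and_eq_true, beq_iff_eq, decide_eq_true_eq] at h
      omega
  | succ d ih =>
    intro k hk hd
    have h := hpar k hk
    unfold parentOK at h
    by_cases hkx : k = root
    · rw [if_pos hkx] at h
      simp only [Bool.and_eq_true, beq_iff_eq] at h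
      omega
    · rw [if_neg hkx] at h
      simp only [Bool.and_eq_true, beq_iff_eq, decide_eq_true_eq] at h
      obtain ⟨⟨hp, hdep⟩, hmem⟩ := h
      exact Relation.ReflTransGen.tail (ih _ hp (by omega)) (List.contains_iff_mem.mp hmem)

/-- Every scheme of `L` is reachable from `X`. -/
theorem reach_of_mem (hn : L.length = n) (hroot : nth L root = X)
    (hpar : ∀ k, k < n → parentOK bu bv n L parent depth root X k = true)
    {t : List ℕ} (ht : t ∈ L) : Relation.ReflTransGen (fun s t : List ℕ => t ∈ flipsP bu bv s) X t := by
  obtain ⟨j, hj, rfl⟩ := exists_nth_of_mem L t ht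
  exact reach_of_depth hroot hpar _ j (by omega) rfl

/-- **The component**: under both certificates, reachable from `X` ⇔ listed in `L`. -/
theorem component_iff (hn : L.length = n) (hrootlt : root < n) (hroot : nth L root = X)
    (hrow : ∀ k, k < n → rowK bu bv n L cert k = true)
    (hpar : ∀ k, k < n → parentOK bu bv n L parent depth root X k = true) (t : List ℕ) :
    Relation.ReflTransGen (fun s t : List ℕ => t ∈ flipsP bu bv s) X t ↔ t ∈ L :=
  ⟨mem_of_reach hn hrow (by rw [← hroot]; exact nth_mem L root (by omega)), reach_of_mem hn hroot hpar⟩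

end Sound

/-- `nodupB` is sound. -/
theorem nodup_of_nodupB : ∀ l : List (List ℕ), nodupB l = true → l.Nodup
  | [], _ => List.nodup_nil
  | a :: l, h => by
    simp only [nodupB, Bool.and_eq_true, Bool.not_eq_true'] at h
    obtain ⟨ha, hl⟩ := h
    refine List.nodup_cons.mpr ⟨fun hm => ?_, nodup_of_nodupB l hl⟩
    rw [List.contains_iff_mem.mpr hm] at ha
    exact Bool.noConfusion ha

/-- The irreducibility check is sound. -/
theorem not_reducible_of_all {bu bv : ℕ} {L : List (List ℕ)} (h : L.all (fun s => !reducibleB bu bv s) = true)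
    {t : List ℕ} (ht : t ∈ L) : reducibleB bu bv t = false := by
  rw [List.all_eq_true] at h
  simpa using h t ht

/-! ### Linear-time duplicate-freeness via strict lexicographic order (appended 2026-08-20, for the larger instances) -/

/-- Strict lexicographic order on lists of naturals (Boolean). -/
def ltL : List ℕ → List ℕ → Bool
  | [], [] => false
  | [], _ :: _ => true
  | _ :: _, [] => false
  | a :: s, b :: t => decide (a < b) || (a == b && ltL s t)

/-- `ltL` is irreflexive. -/
theorem ltL_irrefl : ∀ s : List ℕ, ltL s s = false
  | [] => rfl
  | a :: s => by simp [ltL, ltL_irrefl s]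

/-- `ltL` is transitive. -/
theorem ltL_trans : ∀ s t u : List ℕ, ltL s t = true → ltL t u = true → ltL s u = true
  | [], [], u, h, _ => by simp [ltL] at h
  | [], _ :: _, [], _, h => by simp [ltL] at h
  | [], _ :: _, _ :: _, _, _ => by simp [ltL]
  | _ :: _, [], _, h, _ => by simp [ltL] at h
  | _ :: _, _ :: _, [], _, h => by simp [ltL] at h
  | a :: s, b :: t, c :: u, h1, h2 => by
    simp only [ltL, Bool.or_eq_true, decide_eq_true_eq, Bool.and_eq_true, beq_iff_eq] at h1 h2 ⊢
    rcases h1 with h1 | ⟨rfl, h1⟩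
    · rcases h2 with h2 | ⟨rfl, h2⟩
      · exact Or.inl (by omega)
      · exact Or.inl h1
    · rcases h2 with h2 | ⟨rfl, h2⟩
      · exact Or.inl h2
      · exact Or.inr ⟨rfl, ltL_trans s t u h1 h2⟩

/-- Boolean check: consecutive entries strictly increasing (linear in the list length, unlike `nodupB`). -/
def chainB : List (List ℕ) → Bool
  | [] => true
  | [_] => true
  | a :: b :: l => ltL a b && chainB (b :: l)

/-- In a strictly increasing chain every later element is above the head. -/
theorem chain_head_lt : ∀ (a : List ℕ) (l : List (List ℕ)), chainB (a :: l) = true → ∀ b ∈ l, ltL a b = true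
  | _, [], _, b, hb => absurd hb (by simp)
  | a, c :: l, h, b, hb => by
    simp only [chainB, Bool.and_eq_true] at h
    rcases List.mem_cons.mp hb with rfl | hb'
    · exact h.1
    · exact ltL_trans a c b h.1 (chain_head_lt c l h.2 b hb')

/-- A strictly increasing chain is duplicate-free. -/
theorem nodup_of_chainB : ∀ l : List (List ℕ), chainB l = true → l.Nodup
  | [], _ => List.nodup_nil
  | a :: l, h => by
    refine List.nodup_cons.mpr ⟨fun hm => ?_, nodup_of_chainB l ?_⟩
    · have := chain_head_lt a l h a hm
      rw [ltL_irrefl] at this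
      exact Bool.noConfusion this
    · cases l with
      | nil => rfl
      | cons b l' => simp only [chainB, Bool.and_eq_true] at h; exact h.2

end Summit.MatrixMultiplication.OmegaCensus.FlipComponentGF2
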